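import Summits.QuantumFields.YangMills.Theorems.BalabanLadderIROddTorusChessboardRows
import HarnessLib

/-!
# The reflection Cauchy–Schwarz inequality of the odd-torus chessboard functional in the time direction

Support file (seat ym-infvol-p3, fleet R136 (i); bears on crux `IR` = stmt-QuantumFields-19354, registered line
«af-pincer-T» clause (iii_T) of `TypShellCond` / line «hamming» clause (ii); count-neutral helper).

For one plaquette orientation `o` of the Wilson theory on the odd torus `(ℤ/L)^d`, `L = 2S+1 ≥ 3`, `0 ≤ c ≤ β`, the
chessboard functional `ψ_o(A) = ⟨exp(c ∑_{x∈A} φ_{toPlaq o x})⟩_{Λ,β}` of `…OddTorusChessboardRows` satisfies the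
hypothesis of the abstract odd-side chessboard estimate in the direction `0`:
`ψ_o(A)² ≤ ψ_o(csymP 0 A) · ψ_o(symM 0 1 A)` (`psi_sq_le_zero`).  The pattern `A` is split by the value of the
`0`-th coordinate into LOW rows `{1,…,S}`, the FIXED row `S+1` and HIGH rows `{0, S+2, …, 2S}`; for a transverse
orientation the low rows are positive plaquettes and the fixed row is shared, for an in-plane orientation the high
rows are positive plaquettes and the fixed row is cut (`rows_transverse`, `rows_inplane`); either way the weighted
reflection Cauchy–Schwarz inequality `sq_wilsonExpectation_mul_timeReflect_mul_expObs_le` applies, and its two factors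
are `ψ_o` of the closed-half symmetrisations.

HONEST FRAMING: finite-torus bookkeeping; no claim about the mass gap.
-/

noncomputable section

open MeasureTheory Finset
open Literature.MathematicalPhysics.QuantumFieldTheory
open Literature.MathematicalPhysics.QuantumFieldTheory.WilsonRP
open Literature.MathematicalPhysics.QuantumFieldTheory.WilsonOddRP
open Literature.Barriers.CriticalPhenomena.NonGibbs
open Literature.Probability.LatticeModels
open Summit.QuantumFields.YangMills.Theorems.SoloBlind

namespace Summit.QuantumFields.YangMills.Theorems.OddTorusChessboard

variable {d L N : ℕ} [NeZero d] [NeZero L] {G : Type*} [Group G] [TopologicalSpace G]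
  [IsTopologicalGroup G] [CompactSpace G] [MeasurableSpace G] [BorelSpace G]
  (ρ : G →* Matrix (Fin N) (Fin N) ℂ)

/-! ### §1. The value of `1 - t` on the odd cycle -/

omit [NeZero d] in
/-- The value of `1 - t` in `ZMod L`, `L` odd, `L > 1`. -/
theorem val_one_sub_odd (hL : Odd L) (hL1 : 1 < L) (t : ZMod L) :
    (1 - t).val = if t.val ≤ 1 then 1 - t.val else 1 + L - t.val := by
  obtain ⟨S, rfl⟩ := hL
  have ht := ZMod.val_lt t
  have h1 : (1 : ZMod (2 * S + 1)) - t = ((1 : ℕ) : ZMod _) - (t.val : ZMod _) := by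
    rw [ZMod.natCast_zmod_val, Nat.cast_one]
  rw [h1]
  split_ifs with h
  · rw [← Nat.cast_sub h, ZMod.val_cast_of_lt (by omega)]
  · have : ((1 : ℕ) : ZMod (2 * S + 1)) - ((t.val : ℕ) : ZMod (2 * S + 1)) =
        ((1 + (2 * S + 1) - t.val : ℕ) : ZMod _) := by
      rw [sub_eq_iff_eq_add, ← Nat.cast_add, Nat.sub_add_cancel (by omega), Nat.cast_add, ZMod.natCast_self,
        add_zero]
    rw [this, ZMod.val_cast_of_lt (by omega)]

/-! ### §2. Low rows, the fixed row, high rows -/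

/-- The LOW rows `1 ≤ c₀ ≤ S` of a pattern (the open positive half-line of axis `0`). -/
def lowRows (A : Finset (BlockIdx d L)) : Finset (BlockIdx d L) :=
  A.filter fun c => (c 0).val ≠ 0 ∧ (c 0).val ≤ L / 2

/-- The FIXED row `c₀ = S + 1` of a pattern. -/
def fixRow (A : Finset (BlockIdx d L)) : Finset (BlockIdx d L) := A.filter fun c => (c 0).val = L / 2 + 1

/-- The HIGH rows `c₀ ∈ {0, S+2, …, 2S}` of a pattern (the open negative half-line of axis `0`). -/
def highRows (A : Finset (BlockIdx d L)) : Finset (BlockIdx d L) :=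
  A.filter fun c => (c 0).val = 0 ∨ L / 2 + 2 ≤ (c 0).val

omit [NeZero L] in
/-- Membership in `lowRows`. -/
@[simp] theorem mem_lowRows {A : Finset (BlockIdx d L)} {c : BlockIdx d L} :
    c ∈ lowRows A ↔ c ∈ A ∧ ((c 0).val ≠ 0 ∧ (c 0).val ≤ L / 2) := Finset.mem_filter

omit [NeZero L] in
/-- Membership in `fixRow`. -/
@[simp] theorem mem_fixRow {A : Finset (BlockIdx d L)} {c : BlockIdx d L} :
    c ∈ fixRow A ↔ c ∈ A ∧ (c 0).val = L / 2 + 1 := Finset.mem_filter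

omit [NeZero L] in
/-- Membership in `highRows`. -/
@[simp] theorem mem_highRows {A : Finset (BlockIdx d L)} {c : BlockIdx d L} :
    c ∈ highRows A ↔ c ∈ A ∧ ((c 0).val = 0 ∨ L / 2 + 2 ≤ (c 0).val) := Finset.mem_filter

omit [NeZero L] in
/-- The `0`-th coordinate of the reflected block. -/
theorem cellReflect_zero_apply (c : BlockIdx d L) : cellReflect 0 1 c 0 = 1 - c 0 :=
  cellReflect_one_apply_same 0 c

/-- A block of the fixed row is fixed by the reflection. -/
theorem cellReflect_eq_self_of_fix (hL : Odd L) (hL1 : 1 < L) {c : BlockIdx d L} (hc : (c 0).val = L / 2 + 1) :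
    cellReflect 0 1 c = c := by
  have hv := val_one_sub_odd hL hL1 (c 0)
  obtain ⟨S, hS⟩ := hL
  subst hS
  have hS2 : (2 * S + 1) / 2 = S := by omega
  rw [hS2] at hc
  ext m
  by_cases hm : m = 0
  · subst hm
    rw [cellReflect_zero_apply]
    apply ZMod.val_injective
    rw [hv, if_neg (by omega)]
    omega
  · exact cellReflect_apply_of_ne 0 1 c hm

/-- Reflected low rows are high rows (as values of the `0`-th coordinate). -/
theorem high_of_low (hL : Odd L) (hL1 : 1 < L) {c : BlockIdx d L} (hc : (c 0).val ≠ 0 ∧ (c 0).val ≤ L / 2) :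
    (cellReflect 0 1 c 0).val = 0 ∨ L / 2 + 2 ≤ (cellReflect 0 1 c 0).val := by
  have hv := val_one_sub_odd hL hL1 (c 0)
  rw [cellReflect_zero_apply, hv]
  obtain ⟨S, hS⟩ := hL
  subst hS
  have hS2 : (2 * S + 1) / 2 = S := by omega
  rw [hS2] at hc ⊢
  obtain ⟨h0, h1⟩ := hc
  split_ifs with h <;> omega

/-- Reflected high rows are low rows. -/
theorem low_of_high (hL : Odd L) (hL1 : 1 < L) {c : BlockIdx d L} (hc : (c 0).val = 0 ∨ L / 2 + 2 ≤ (c 0).val) :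
    (cellReflect 0 1 c 0).val ≠ 0 ∧ (cellReflect 0 1 c 0).val ≤ L / 2 := by
  have hv := val_one_sub_odd hL hL1 (c 0)
  have hlt := ZMod.val_lt (c 0)
  rw [cellReflect_zero_apply, hv]
  obtain ⟨S, hS⟩ := hL
  subst hS
  have hS2 : (2 * S + 1) / 2 = S := by omega
  rw [hS2] at hc ⊢
  rcases hc with h0 | h0 <;> split_ifs with h <;> omega

/-- **The pattern is the disjoint union of its low rows, fixed row and high rows.** -/
theorem lowRows_union_fixRow_union_highRows (hL : Odd L) (A : Finset (BlockIdx d L)) :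
    lowRows A ∪ fixRow A ∪ highRows A = A := by
  obtain ⟨S, hS⟩ := hL
  ext c
  simp only [Finset.mem_union, mem_lowRows, mem_fixRow, mem_highRows]
  constructor
  · rintro ((⟨h, _⟩ | ⟨h, _⟩) | ⟨h, _⟩) <;> exact h
  · intro h
    have := ZMod.val_lt (c 0)
    by_cases h0 : (c 0).val = 0
    · exact Or.inr ⟨h, Or.inl h0⟩
    by_cases h1 : (c 0).val ≤ L / 2
    · exact Or.inl (Or.inl ⟨h, h0, h1⟩)
    by_cases h2 : (c 0).val = L / 2 + 1
    · exact Or.inl (Or.inr ⟨h, h2⟩)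
    · exact Or.inr ⟨h, Or.inr (by omega)⟩

/-- **The closed positive symmetrisation of axis `0`** is `low ∪ fixed ∪ θ(low)`. -/
theorem csymP_zero_eq (hL : Odd L) (hL1 : 1 < L) (A : Finset (BlockIdx d L)) :
    csymP 0 A = lowRows A ∪ fixRow A ∪ (lowRows A).image (cellReflect 0 1) := by
  have hL' := hL
  obtain ⟨S, hS⟩ := hL
  have hS2 : L / 2 = S := by omega
  ext c
  simp only [csymP, Finset.mem_union, Finset.mem_inter, Finset.mem_image, mem_chalfPlus, mem_lowRows, mem_fixRow]
  constructor
  · rintro (⟨hA, h0, h1⟩ | ⟨b, ⟨hbA, hb0, hb1⟩, rfl⟩)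
    · by_cases hf : (c 0).val = L / 2 + 1
      · exact Or.inl (Or.inr ⟨hA, hf⟩)
      · exact Or.inl (Or.inl ⟨hA, h0, by omega⟩)
    · by_cases hf : (b 0).val = L / 2 + 1
      · rw [cellReflect_eq_self_of_fix hL' hL1 hf]
        exact Or.inl (Or.inr ⟨hbA, hf⟩)
      · exact Or.inr ⟨b, ⟨hbA, hb0, by omega⟩, rfl⟩
  · rintro ((⟨hA, h0, h1⟩ | ⟨hA, hf⟩) | ⟨b, ⟨hbA, hb0, hb1⟩, rfl⟩)
    · exact Or.inl ⟨hA, h0, by omega⟩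
    · exact Or.inl ⟨hA, by omega, by omega⟩
    · exact Or.inr ⟨b, ⟨hbA, hb0, by omega⟩, rfl⟩

/-- **The negative symmetrisation `symM 0 1`** is `high ∪ fixed ∪ θ(high)`. -/
theorem symM_zero_one_eq (hL : Odd L) (hL1 : 1 < L) (A : Finset (BlockIdx d L)) :
    symM 0 1 A = highRows A ∪ fixRow A ∪ (highRows A).image (cellReflect 0 1) := by
  have hL' := hL
  have hv : ∀ t : ZMod L, (t - 1).val = if t.val = 0 then L - 1 else t.val - 1 := fun t => by
    -- (the tree's `UnquenchedChessboardBoundLine.val_sub_one'` in the QCD cone; inlined to keep the import cone small)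
    split_ifs with h
    · rw [(ZMod.val_eq_zero t).1 h, zero_sub, zmod_val_neg_one']
    · have ht := ZMod.val_lt t
      have h1 : t - 1 = ((t.val - 1 : ℕ) : ZMod L) := by
        rw [Nat.cast_sub (by omega), ZMod.natCast_zmod_val, Nat.cast_one]
      rw [h1, ZMod.val_cast_of_lt (by omega)]
  obtain ⟨S, hS⟩ := hL
  have hS2 : L / 2 = S := by omega
  have key : ∀ c : BlockIdx d L, L / 2 ≤ (c 0 - 1).val ↔ ((c 0).val = 0 ∨ L / 2 + 2 ≤ (c 0).val) ∨ (c 0).val = L / 2 + 1 := by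
    intro c
    have := ZMod.val_lt (c 0)
    rw [hv]
    split_ifs with h <;> omega
  ext c
  simp only [symM, Finset.mem_union, Finset.mem_inter, Finset.mem_image, mem_halfMinus, mem_highRows, mem_fixRow,
    key]
  constructor
  · rintro (⟨hA, hh | hf⟩ | ⟨b, ⟨hbA, hh | hf⟩, rfl⟩)
    · exact Or.inl (Or.inl ⟨hA, hh⟩)
    · exact Or.inl (Or.inr ⟨hA, hf⟩)
    · exact Or.inr ⟨b, ⟨hbA, hh⟩, rfl⟩
    · rw [cellReflect_eq_self_of_fix hL' hL1 hf]
      exact Or.inl (Or.inr ⟨hbA, hf⟩)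
  · rintro ((⟨hA, hh⟩ | ⟨hA, hf⟩) | ⟨b, ⟨hbA, hh⟩, rfl⟩)
    · exact Or.inl ⟨hA, Or.inl hh⟩
    · exact Or.inl ⟨hA, Or.inr hf⟩
    · exact Or.inr ⟨b, ⟨hbA, Or.inl hh⟩, rfl⟩

/-! ### §3. The exponential observable of a pattern: unions and reflection -/

omit [NeZero d] [NeZero L] [TopologicalSpace G] [IsTopologicalGroup G] [CompactSpace G] [MeasurableSpace G]
  [BorelSpace G] in
/-- Disjoint patterns give a product of exponential observables. -/
theorem expObs_image_toPlaq_union (c : ℝ) (o : Orient d) {X Y : Finset (BlockIdx d L)} (h : Disjoint X Y)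
    (U : GaugeConfig d L G) :
    expObs ρ c ((X ∪ Y).image (toPlaq o)) U = expObs ρ c (X.image (toPlaq o)) U * expObs ρ c (Y.image (toPlaq o)) U := by
  rw [Finset.image_union, ← expObs_mul_of_disjoint ρ c ((Finset.disjoint_image (toPlaq_injective o)).2 h)]

omit [NeZero L] [MeasurableSpace G] [BorelSpace G] in
/-- Reflecting the configuration reflects the pattern. -/
theorem expObs_image_toPlaq_timeReflect (hL : Odd L) (hρ : Continuous ρ) (c : ℝ) (o : Orient d)
    (X : Finset (BlockIdx d L)) (U : GaugeConfig d L G) :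
    expObs ρ c (X.image (toPlaq o)) U.timeReflect = expObs ρ c ((X.image (cellReflect 0 1)).image (toPlaq o)) U := by
  rw [expObs_timeReflect ρ hρ, image_toPlaq_image_cellReflect_zero hL]

omit [NeZero L] in
/-- Reflecting twice. -/
theorem image_cellReflect_image_cellReflect (X : Finset (BlockIdx d L)) :
    (X.image (cellReflect 0 1)).image (cellReflect 0 1) = X := by
  rw [Finset.image_image]
  convert Finset.image_id (s := X) using 2
  funext c
  exact cellReflect_cellReflect 0 1 c

/-! ### §4. The core Cauchy–Schwarz step -/

section Core

variable [Fact (1 < L)]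

/-- **Core step.**  For disjoint patterns `X` (positive plaquettes), `F` (cut or shared plaquettes, fixed by the
reflection) and `Y` (whose reflection consists of positive plaquettes):
`ψ_o(X ∪ F ∪ Y)² ≤ ψ_o(X ∪ F ∪ θX) · ψ_o(θY ∪ F ∪ Y)`. -/
theorem psi_sq_le_core (hL : Odd L) (hL3 : 3 ≤ L) (hρ : Continuous ρ) {β c : ℝ} (hc : 0 ≤ c) (hcβ : c ≤ β)
    (o : Orient d) {X F Y : Finset (BlockIdx d L)}
    (hXF : Disjoint X F) (hXFY : Disjoint (X ∪ F) Y) (hXFθ : Disjoint (X ∪ F) (X.image (cellReflect 0 1)))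
    (hθFY : Disjoint (Y.image (cellReflect 0 1) ∪ F) Y) (hθF : Disjoint (Y.image (cellReflect 0 1)) F)
    (hX : ∀ x ∈ X, IsOPosPlaq (toPlaq o x)) (hY : ∀ y ∈ Y, IsOPosPlaq (toPlaq o (cellReflect 0 1 y)))
    (hF : ∀ f ∈ F, IsOCrossPlaq (toPlaq o f) ∨ IsOSharedPlaq (toPlaq o f)) :
    psi (G := G) ρ β c o (X ∪ F ∪ Y) ^ 2 ≤
      psi ρ β c o (X ∪ F ∪ X.image (cellReflect 0 1)) * psi ρ β c o (Y.image (cellReflect 0 1) ∪ F ∪ Y) := by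
  -- the three observables
  set Fo : GaugeConfig d L G → ℝ := expObs ρ c (X.image (toPlaq o)) with hFo
  set Go : GaugeConfig d L G → ℝ := expObs ρ c ((Y.image (cellReflect 0 1)).image (toPlaq o)) with hGo
  set B : Finset (Plaquette d L) := F.image (toPlaq o) with hB
  have hBcs : ∀ q ∈ B, IsOCrossPlaq q ∨ IsOSharedPlaq q := by
    intro q hq
    obtain ⟨f, hf, rfl⟩ := Finset.mem_image.1 hq
    exact hF f hf
  have hXpos : ∀ q ∈ X.image (toPlaq o), IsOPosPlaq q := by
    intro q hq; obtain ⟨x, hx, rfl⟩ := Finset.mem_image.1 hq; exact hX x hx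
  have hYpos : ∀ q ∈ (Y.image (cellReflect 0 1)).image (toPlaq o), IsOPosPlaq q := by
    intro q hq
    obtain ⟨y', hy', rfl⟩ := Finset.mem_image.1 hq
    obtain ⟨y, hy, rfl⟩ := Finset.mem_image.1 hy'
    exact hY y hy
  obtain ⟨F₀, hFb⟩ := exists_abs_expObs_le (G := G) ρ hρ c (X.image (toPlaq o))
  obtain ⟨G₀, hGb⟩ := exists_abs_expObs_le (G := G) ρ hρ c ((Y.image (cellReflect 0 1)).image (toPlaq o))
  have key := sq_wilsonExpectation_mul_timeReflect_mul_expObs_le ρ hL hL3 hρ hc hcβ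
    (measurable_expObs ρ hρ c _) hFb (dependsOn_expObs_of_pos ρ hL c hXpos)
    (measurable_expObs ρ hρ c _) hGb (dependsOn_expObs_of_pos ρ hL c hYpos) B hBcs
  -- identify the three expectations with values of `ψ`
  have hGoΘ : ∀ U : GaugeConfig d L G,
      expObs ρ c ((Y.image (cellReflect 0 1)).image (toPlaq o)) U.timeReflect = expObs ρ c (Y.image (toPlaq o)) U := by
    intro U
    rw [expObs_image_toPlaq_timeReflect ρ hL hρ, image_cellReflect_image_cellReflect]
  have hFoΘ : ∀ U : GaugeConfig d L G,
      expObs ρ c (X.image (toPlaq o)) U.timeReflect = expObs ρ c ((X.image (cellReflect 0 1)).image (toPlaq o)) U :=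
    fun U => expObs_image_toPlaq_timeReflect ρ hL hρ c o X U
  have e1 : (wilsonExpectation ρ β fun U : GaugeConfig d L G => Fo U * Go U.timeReflect * expObs ρ c B U) =
      psi ρ β c o (X ∪ F ∪ Y) := by
    unfold psi
    congr 1
    funext U
    rw [expObs_image_toPlaq_union ρ c o hXFY, expObs_image_toPlaq_union ρ c o hXF, hFo, hGo, hB, hGoΘ]
    ring
  have e2 : (wilsonExpectation ρ β fun U : GaugeConfig d L G => Fo U * Fo U.timeReflect * expObs ρ c B U) =
      psi ρ β c o (X ∪ F ∪ X.image (cellReflect 0 1)) := by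
    unfold psi
    congr 1
    funext U
    rw [expObs_image_toPlaq_union ρ c o hXFθ, expObs_image_toPlaq_union ρ c o hXF, hFo, hB, hFoΘ]
    ring
  have e3 : (wilsonExpectation ρ β fun U : GaugeConfig d L G => Go U * Go U.timeReflect * expObs ρ c B U) =
      psi ρ β c o (Y.image (cellReflect 0 1) ∪ F ∪ Y) := by
    unfold psi
    congr 1
    funext U
    rw [expObs_image_toPlaq_union ρ c o hθFY, expObs_image_toPlaq_union ρ c o hθF, hGo, hB, hGoΘ]
    ring
  rw [e1, e2, e3] at key
  exact key

end Core

/-! ### §5. The Schwarz inequality in the direction `0`, both kinds of orientation -/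

section Zero

variable [Fact (1 < L)]

omit [Fact (1 < L)] in
/-- Disjointness bookkeeping for the low/fixed/high decomposition. -/
theorem rows_disjoint (hL : Odd L) (hL1 : 1 < L) (A : Finset (BlockIdx d L)) :
    Disjoint (lowRows A) (fixRow A) ∧ Disjoint (lowRows A ∪ fixRow A) (highRows A) ∧
      Disjoint (lowRows A ∪ fixRow A) ((lowRows A).image (cellReflect 0 1)) ∧
      Disjoint ((highRows A).image (cellReflect 0 1) ∪ fixRow A) (highRows A) ∧
      Disjoint ((highRows A).image (cellReflect 0 1)) (fixRow A) ∧
      Disjoint (highRows A) (fixRow A) ∧ Disjoint (highRows A ∪ fixRow A) (lowRows A) ∧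
      Disjoint (highRows A ∪ fixRow A) ((highRows A).image (cellReflect 0 1)) ∧
      Disjoint ((lowRows A).image (cellReflect 0 1) ∪ fixRow A) (lowRows A) ∧
      Disjoint ((lowRows A).image (cellReflect 0 1)) (fixRow A) := by
  have hlow : ∀ c ∈ (lowRows A).image (cellReflect 0 1), (c 0).val = 0 ∨ L / 2 + 2 ≤ (c 0).val := by
    intro c hc
    obtain ⟨b, hb, rfl⟩ := Finset.mem_image.1 hc
    exact high_of_low hL hL1 (mem_lowRows.1 hb).2
  have hhigh : ∀ c ∈ (highRows A).image (cellReflect 0 1), (c 0).val ≠ 0 ∧ (c 0).val ≤ L / 2 := by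
    intro c hc
    obtain ⟨b, hb, rfl⟩ := Finset.mem_image.1 hc
    exact low_of_high hL hL1 (mem_highRows.1 hb).2
  obtain ⟨S, hS⟩ := hL
  simp only [Finset.disjoint_left, Finset.mem_union, mem_lowRows, mem_fixRow, mem_highRows]
  refine ⟨?_, ?_, ?_, ?_, ?_, ?_, ?_, ?_, ?_, ?_⟩
  · rintro c ⟨_, h1, h2⟩ ⟨_, h3⟩; omega
  · rintro c (⟨_, h1, h2⟩ | ⟨_, h1⟩) ⟨_, h3⟩ <;> omega
  · rintro c (⟨_, h1, h2⟩ | ⟨_, h1⟩) h3 <;> have := hlow c h3 <;> omega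
  · rintro c (h1 | ⟨_, h1⟩) ⟨_, h3⟩
    · have := hhigh c h1; omega
    · omega
  · rintro c h1 ⟨_, h3⟩; have := hhigh c h1; omega
  · rintro c ⟨_, h1⟩ ⟨_, h3⟩; omega
  · rintro c (⟨_, h1⟩ | ⟨_, h1⟩) ⟨_, h3, h4⟩ <;> omega
  · rintro c (⟨_, h1⟩ | ⟨_, h1⟩) h3 <;> have := hhigh c h3 <;> omega
  · rintro c (h1 | ⟨_, h1⟩) ⟨_, h3, h4⟩
    · have := hlow c h1; omega
    · omega
  · rintro c h1 ⟨_, h3⟩; have := hlow c h1; omega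

/-- **The Schwarz inequality of the odd-torus chessboard in the direction `0`**:
`ψ_o(A)² ≤ ψ_o(csymP 0 A) · ψ_o(symM 0 1 A)` for every orientation `o` and every pattern `A`
(`L` odd, `L ≥ 3`, `0 ≤ c ≤ β`, continuous `ρ`). -/
theorem psi_sq_le_zero (hL : Odd L) (hL3 : 3 ≤ L) (hρ : Continuous ρ) {β c : ℝ} (hc : 0 ≤ c) (hcβ : c ≤ β)
    (o : Orient d) (A : Finset (BlockIdx d L)) :
    psi (G := G) ρ β c o A ^ 2 ≤ psi ρ β c o (csymP 0 A) * psi ρ β c o (symM 0 1 A) := by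
  have hL1 : 1 < L := by omega
  obtain ⟨d1, d2, d3, d4, d5, d6, d7, d8, d9, d10⟩ := rows_disjoint (d := d) hL hL1 A
  have rot : ∀ X F Y : Finset (BlockIdx d L), X ∪ F ∪ Y = Y ∪ F ∪ X := fun X F Y => by
    ext x; simp only [Finset.mem_union]; tauto
  rw [csymP_zero_eq hL hL1, symM_zero_one_eq hL hL1]
  by_cases ho : o.1.1 = 0
  · -- in-plane: high rows positive, fixed row cut, reflected low rows positive
    have hX : ∀ x ∈ highRows A, IsOPosPlaq (toPlaq o x) := fun x hx =>
      (rows_inplane hL hL3 ho x).1 (mem_highRows.1 hx).2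
    have hY : ∀ y ∈ lowRows A, IsOPosPlaq (toPlaq o (cellReflect 0 1 y)) := fun y hy =>
      (rows_inplane hL hL3 ho _).1 (high_of_low hL hL1 (mem_lowRows.1 hy).2)
    have hF : ∀ f ∈ fixRow A, IsOCrossPlaq (toPlaq o f) ∨ IsOSharedPlaq (toPlaq o f) := fun f hf =>
      Or.inl ((rows_inplane hL hL3 ho f).2 (mem_fixRow.1 hf).2)
    have h := psi_sq_le_core ρ hL hL3 hρ hc hcβ o d6 d7 d8 d9 d10 hX hY hF
    rw [rot (highRows A) (fixRow A) (lowRows A), lowRows_union_fixRow_union_highRows hL A,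
      rot ((lowRows A).image (cellReflect 0 1)) (fixRow A) (lowRows A), mul_comm] at h
    exact h
  · -- transverse: low rows positive, fixed row shared, reflected high rows positive
    have hX : ∀ x ∈ lowRows A, IsOPosPlaq (toPlaq o x) := fun x hx =>
      (rows_transverse ho x).1 (mem_lowRows.1 hx).2
    have hY : ∀ y ∈ highRows A, IsOPosPlaq (toPlaq o (cellReflect 0 1 y)) := fun y hy =>
      (rows_transverse ho _).1 (low_of_high hL hL1 (mem_highRows.1 hy).2)
    have hF : ∀ f ∈ fixRow A, IsOCrossPlaq (toPlaq o f) ∨ IsOSharedPlaq (toPlaq o f) := fun f hf =>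
      Or.inr ((rows_transverse ho f).2 (mem_fixRow.1 hf).2)
    have h := psi_sq_le_core ρ hL hL3 hρ hc hcβ o d1 d2 d3 d4 d5 hX hY hF
    rw [lowRows_union_fixRow_union_highRows hL A, rot ((highRows A).image (cellReflect 0 1)) (fixRow A) (highRows A)] at h
    exact h

end Zero

end Summit.QuantumFields.YangMills.Theorems.OddTorusChessboard

end
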